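import Summits.ValiantsHypothesis.ValiantsHypothesis.Theses.BarrierLever

/-!
# Route BarrierLever — Chow witnesses for partition minors (item 20172, CPM): the MATCHING-GENERICITY
# door «masked partition minors of ONE product of `2h` affine forms are nonzero whenever the mask
# carries a permutation ⇒ CPM», and its trivial converse

Helper file (`--supports stmt-ValiantsHypothesis-20172`; cell valiant-natproofs, rung V4, 𝒟-side of
door (c); seat valiant-natproofs-prover gen 13).  Closes NO item; declares NO definition (the
conjecture text appears only as a HYPOTHESIS).

Conventions of items 19717 / 20172 / 20195: `x_a = X (Fin.castAdd h a)`, `y_c = X (Fin.natAdd h c)`,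
`E u w = Σ_{a∈u} e_{x_a} + Σ_{c∈w} e_{y_c}`; a layout `(u, w)` is HIT when some product of `h + h` affine
forms `ℓ_k` has `det[coeff_{E (u i) (w j)} ∏ ℓ] ≠ 0`.

**The conjecture (GEN), «Chow tables are matching-generic»** (memo HOME/prover/gen13/MEMO-slots-corners-g13.md
§0.6; numerics: kit j283974 + seat folder lab/, ≈ 1.9·10⁵ exact adversarial tests at `h ≤ 5` with
0 mismatches): for all large `h`, every injective layout `(u, w)` and every MASK `S ⊆ Fin r × Fin r`
that contains the graph of a permutation, some product of `h + h` affine forms has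
`det[ [(i,j) ∈ S] · coeff_{E (u i) (w j)} ∏ ℓ ] ≠ 0` — i.e. the partition matrix of a generic product is
as generic as a matrix of independent indeterminates with respect to every «matching polynomial».
Item 20172 is the unmasked case `S = univ`:

* `chowHitsPartitionMinors_of_matchingGeneric` — **(GEN) ⇒ `ChowHitsPartitionMinors`** (hypothesis
  verbatim, `S = Finset.univ`, the permutation `1`).
* `det_mask_eq_zero_of_no_perm` — **the converse direction is a theorem for EVERY matrix**: if `S`
  contains the graph of no permutation, the `S`-masked determinant vanishes (Leibniz: every term has a
  factor outside `S`); `chow_masked_det_eq_zero_of_no_perm` — the instance for partition matrices, so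
  the permutation hypothesis in (GEN) is exactly the non-trivial locus.

Why this door: (GEN) — unlike CPM — is closed under the Sylvester step `M_{ℓF} = (1 + Σα_a S_a)·M_F +
M_F·(Σγ_c S_c)ᵀ` (masked layouts go to masked layouts; memo §0.1/§0.5), so it is the natural carrier of
an induction on the number of forms; and every decoupled / product-state / read-once design violates it
(their tables satisfy cycle-product identities), which is the uniform reason those designs die.

WHAT THIS IS NOT: (GEN) is OPEN (a conjecture strictly stronger than item 20172); no layout is hit
here; nothing on items 20172 / 20195 / 19717 themselves, on crux stmt-ValiantsHypothesis-14610, or on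
`VP` versus `VNP`.
-/

set_option linter.dupNamespace false

namespace Summit.ValiantsHypothesis.ValiantsHypothesis.Theorems.BarrierLever.ChowFactor

open Finset MvPolynomial

noncomputable section

/-! ## 1. Masks without a permutation kill every determinant -/

/-- **A mask carrying no permutation kills the determinant** (any commutative ring, any matrix):
if no permutation `σ` has all `(i, σ i) ∈ S`, then `det[ [(i,j) ∈ S] · A i j ] = 0`. -/
theorem det_mask_eq_zero_of_no_perm {R : Type*} [CommRing R] {r : ℕ} (A : Matrix (Fin r) (Fin r) R)
    (S : Finset (Fin r × Fin r)) (hS : ¬ ∃ σ : Equiv.Perm (Fin r), ∀ i, (i, σ i) ∈ S) :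
    (Matrix.of fun i j : Fin r => if (i, j) ∈ S then A i j else 0).det = 0 := by
  classical
  rw [Matrix.det_apply]
  refine Finset.sum_eq_zero fun σ _ => ?_
  -- the permutation `σ⁻¹` leaves `S` somewhere: at `j := σ⁻¹ i₀`... we use `σ.symm`
  have hσ : ∃ i, (i, σ.symm i) ∉ S := by
    by_contra hall
    push Not at hall
    exact hS ⟨σ.symm, hall⟩
  obtain ⟨i₀, hi₀⟩ := hσ
  have hzero : (∏ i, (Matrix.of fun i j : Fin r => if (i, j) ∈ S then A i j else 0) (σ i) i) = 0 := by
    refine Finset.prod_eq_zero (Finset.mem_univ (σ.symm i₀)) ?_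
    rw [Matrix.of_apply, Equiv.apply_symm_apply, if_neg hi₀]
  rw [hzero, smul_zero]

variable {h : ℕ}

/-- **The converse of (GEN) for partition matrices**: a mask without a permutation kills the masked
partition minor of EVERY polynomial (in particular of every product of affine forms). -/
theorem chow_masked_det_eq_zero_of_no_perm {r : ℕ} (u w : Fin r → Finset (Fin h))
    (S : Finset (Fin r × Fin r)) (hS : ¬ ∃ σ : Equiv.Perm (Fin r), ∀ i, (i, σ i) ∈ S)
    (f : MvPolynomial (Fin (h + h)) ℂ) :
    (Matrix.of fun i j : Fin r => if (i, j) ∈ S then coeff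
        (∑ a ∈ u i, Finsupp.single (Fin.castAdd h a) 1 + ∑ c ∈ w j, Finsupp.single (Fin.natAdd h c) 1)
        f else 0).det = 0 :=
  det_mask_eq_zero_of_no_perm (Matrix.of fun i j : Fin r => coeff
    (∑ a ∈ u i, Finsupp.single (Fin.castAdd h a) 1 + ∑ c ∈ w j, Finsupp.single (Fin.natAdd h c) 1) f)
    S hS

/-! ## 2. (GEN) ⇒ CPM -/

/-- **(GEN) ⇒ item 20172 `ChowHitsPartitionMinors`.**  The hypothesis is the matching-genericity
conjecture verbatim: for all large `h`, every injective layout and every mask `S` containing the graph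
of a permutation admit a product of `h + h` affine forms with nonzero `S`-masked partition minor.
The unmasked case `S = univ` (permutation `1`) is CPM. -/
theorem chowHitsPartitionMinors_of_matchingGeneric
    (H : ∃ h₀ : ℕ, ∀ h : ℕ, h₀ ≤ h → ∀ (r : ℕ) (u w : Fin r → Finset (Fin h)) (S : Finset (Fin r × Fin r)),
      Function.Injective u → Function.Injective w →
      (∃ σ : Equiv.Perm (Fin r), ∀ i, (i, σ i) ∈ S) →
      ∃ ℓ : Fin (h + h) → MvPolynomial (Fin (h + h)) ℂ, (∀ k, (ℓ k).totalDegree ≤ 1) ∧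
        (Matrix.of fun i j : Fin r => if (i, j) ∈ S then MvPolynomial.coeff
          (∑ a ∈ u i, Finsupp.single (Fin.castAdd h a) 1 + ∑ c ∈ w j, Finsupp.single (Fin.natAdd h c) 1)
          (∏ k, ℓ k) else 0).det ≠ 0) :
    Theses.BarrierLever.ChowHitsPartitionMinors := by
  classical
  obtain ⟨h₀, H⟩ := H
  refine ⟨h₀, fun h hh r u w hu hw => ?_⟩
  obtain ⟨ℓ, hdeg, hdet⟩ := H h hh r u w Finset.univ hu hw ⟨1, fun i => Finset.mem_univ _⟩
  refine ⟨ℓ, hdeg, ?_⟩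
  have hM : (Matrix.of fun i j : Fin r => if (i, j) ∈ (Finset.univ : Finset (Fin r × Fin r)) then
      MvPolynomial.coeff
        (∑ a ∈ u i, Finsupp.single (Fin.castAdd h a) 1 + ∑ c ∈ w j, Finsupp.single (Fin.natAdd h c) 1)
        (∏ k, ℓ k) else 0) =
      Matrix.of fun i j : Fin r => MvPolynomial.coeff
        (∑ a ∈ u i, Finsupp.single (Fin.castAdd h a) 1 + ∑ c ∈ w j, Finsupp.single (Fin.natAdd h c) 1)
        (∏ k, ℓ k) := by
    ext i j
    rw [Matrix.of_apply, Matrix.of_apply, if_pos (Finset.mem_univ _)]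
  rw [hM] at hdet
  exact hdet

end

end Summit.ValiantsHypothesis.ValiantsHypothesis.Theorems.BarrierLever.ChowFactor
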